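import Summits.AnomalousDissipation.AnomalousDissipation.Theorems.BaireTransferDefs
import Literature.Analysis.FluidPDE.DoeringFoiasProofs
import Literature.Analysis.FluidPDE.DoeringFoiasPowerProofs

/-!
# `DenseLoudLerayHopfForces` (stmt-AnomalousDissipation-1149), II: kill shape and Leray–Hopf witness anatomy

Companion of `BaireTransferDefs` (objects `lhLoudSet`; LH-windows unbundled) and `…Reductions` (necessity
`DenseLoudDesignerForces → DenseLoudLerayHopfForces`, Baire transfer at the Leray–Hopf level).  Nothing here closes
the item; the file records what is certifiable today on the NEGATIVE side of it.

* §2 KILL SHAPE (route kill criterion K4 in Baire–Osgood form): `¬ DenseLoudLerayHopfForces` iff some finite stock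
  `S₀` is such that for all `S ⊇ S₀`, all budgets and every open `U ≠ ∅` some level `j` has an open non-empty
  `V ⊆ U` disjoint from `LHLOUD_j` — a UNIFORM local-quietness theorem for ALL global Leray–Hopf solutions (all
  finite-energy data) under fixed-degree steady forcing at small viscosity; nothing less refutes the item.
* §3 MONOTONICITY: `LHLOUD_j` is antitone in the level and monotone in the budgets; loudness eventually in `j`
  suffices.
* §4 LERAY–HOPF POWER SHELL.  By the tree's discharged Doering–Foias chain for Leray–Hopf solutions with a steady
  smooth mean-zero force (`DoeringFoias2002_dissipation_le_power_holds`: `⟨ν‖∇u‖²⟩ ≤ ⟨∫⟪f,u⟫⟩` from the energy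
  inequality; `Torus.IsGlobalLerayHopf.meanPower_le`: `⟨∫⟪f,u⟫⟩ ≤ ‖f‖₂⟨‖u‖²⟩^{1/2}` by Cauchy–Schwarz, Jensen and
  the a-priori bound on the Cesàro energies, so the `limsup`s are honest) EVERY Leray–Hopf witness obeys
  `meanDissipation ≤ ‖f_c‖₂ √meanEnergy` (`meanDissipation_le_of_isGlobalLerayHopf`), whence on `LHLOUD_j`:
  `ε² ≤ (∫‖f_c‖²)·E ≤ (∑‖c k‖²)·E ≤ #S‖c‖²E` (closed shell, independent of `j` and of the datum),
  `0 ∉ closure LHLOUD_j`, no LH-window contains the rest state, `P_S` is never an LH-window, an LH-window forces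
  `E > 0`, and `LHLOUD_j = ∅` over a degenerate stock `S ⊆ {0}` — the refuted strengthenings AtRest / Everywhere /
  SameStock of the crux persist for the weaker item.

Reading.  The only a-priori information valid for ALL Leray–Hopf witnesses that the tree certifies today is this
energy/power bookkeeping, linear–quadratic in `u`; it closes against the budgets `E, ε`, which the prover of the
item chooses AFTER the window — no contradiction.  A kill (§2) needs the injected power `⟨∫⟪f_c,u⟫⟩` of every
bounded Leray–Hopf solution to vanish as `ν → 0`, uniformly near a dense set of fixed-degree forces: the negative
zeroth law on that force class (open; by `Cheskidov2023_thm13_not_forceRobustNoAnomaly` scope (d) it must use the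
degree bound / steadiness of `f_c`, not `L²`-robust energy methods).
-/

noncomputable section

-- `Summit.<Summit>.<Problem>` is the tree's mandated summit-side namespace (CONVENTIONS §2); for this
-- single-conjunct summit the two coincide, so the duplicate is deliberate.
set_option linter.dupNamespace false

namespace Summit.AnomalousDissipation.AnomalousDissipation.Theorems.DenseLoudLerayHopfForces

open scoped BigOperators Topology ENNReal InnerProductSpace
open Filter Set MeasureTheory UnitAddTorus
open Literature.Analysis.FunctionSpaces Literature.Analysis.FluidPDE
open Summit.AnomalousDissipation.AnomalousDissipation.Theses.BaireTransfer
open Summit.AnomalousDissipation.AnomalousDissipation.Theorems.DenseLoudDesignerForces.Negative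

/-! ## §2 Exact shape of a kill (Baire–Osgood form) -/

/-- KILL SHAPE.  `¬ DenseLoudLerayHopfForces` iff there is a finite stock `S₀` such that for every `S ⊇ S₀`, all
budgets `E`, `ε > 0` and every open non-empty `U ⊆ P_S`, some level `j` has a non-empty open `V ⊆ U` DISJOINT from
`LHLOUD_j(S,E,ε)`: a refutation is a uniform local-quietness theorem for ALL global Leray–Hopf solutions (all data)
under fixed-degree steady forcing at small viscosity. -/
theorem not_denseLoudLerayHopfForces_iff :
    ¬ DenseLoudLerayHopfForces ↔
      ∃ S₀ : Finset (Fin 3 → ℤ), ∀ S : Finset (Fin 3 → ℤ), S₀ ⊆ S → ∀ (E ε : ℝ), 0 < ε →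
        ∀ U : Set (↥S → (EuclideanSpace ℂ (Fin 3))), IsOpen U → U.Nonempty →
          ∃ j : ℕ, ∃ V : Set (↥S → (EuclideanSpace ℂ (Fin 3))),
            IsOpen V ∧ V.Nonempty ∧ V ⊆ U ∧ Disjoint V (lhLoudSet S E ε j) := by
  rw [denseLoudLerayHopfForces_iff]
  constructor
  · intro h
    push Not at h
    obtain ⟨S₀, hS₀⟩ := h
    refine ⟨S₀, fun S hS E ε hε U hU hUne => ?_⟩
    obtain ⟨j, hj⟩ := hS₀ S hS E ε hε U hU hUne
    rw [Set.not_subset] at hj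
    obtain ⟨c, hcU, hc⟩ := hj
    rw [mem_closure_iff] at hc
    push Not at hc
    obtain ⟨V, hV, hcV, hVd⟩ := hc
    refine ⟨j, V ∩ U, hV.inter hU, ⟨c, hcV, hcU⟩, inter_subset_right, ?_⟩
    rw [Set.disjoint_iff_inter_eq_empty, ← Set.subset_empty_iff, ← hVd]
    exact fun x hx => ⟨hx.1.1, hx.2⟩
  · rintro ⟨S₀, h⟩ hD
    obtain ⟨S, hS, E, ε, hε, U, hU, hUne, hW⟩ := hD S₀
    obtain ⟨j, V, hV, ⟨c, hcV⟩, hVU, hdisj⟩ := h S hS E ε hε U hU hUne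
    have hc : c ∈ closure (lhLoudSet S E ε j) := hW j (hVU hcV)
    rw [mem_closure_iff] at hc
    obtain ⟨x, hxV, hxL⟩ := hc V hV hcV
    exact Set.disjoint_left.1 hdisj hxV hxL

/-! ## §3 Monotonicity: only small viscosities matter -/

/-- `LHLOUD_{j'} ⊆ LHLOUD_j` for `j ≤ j'` (the viscosity window shrinks). -/
theorem lhLoudSet_antitone (S : Finset (Fin 3 → ℤ)) (E ε : ℝ) : Antitone (lhLoudSet S E ε) := by
  intro j j' hjj' c hc
  obtain ⟨ν, hν, hνj, rest⟩ := hc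
  refine ⟨ν, hν, lt_of_lt_of_le hνj ?_, rest⟩
  have h1 : (0 : ℝ) < (j : ℝ) + 1 := by positivity
  exact one_div_le_one_div_of_le h1 (by exact_mod_cast Nat.add_le_add_right hjj' 1)

/-- The Leray–Hopf loud sets grow with the energy budget and shrink with the dissipation floor. -/
theorem lhLoudSet_mono_budgets (S : Finset (Fin 3 → ℤ)) {E E' ε ε' : ℝ} (hE : E ≤ E') (hε : ε' ≤ ε) (j : ℕ) :
    lhLoudSet S E ε j ⊆ lhLoudSet S E' ε' j := by
  rintro c ⟨ν, hν, hνj, u₀, u, hu, hEu, hεu⟩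
  exact ⟨ν, hν, hνj, u₀, u, hu, hEu.trans hE, hε.trans hεu⟩

/-- Density of the Leray–Hopf loud sets in `U` for `(E, ε)` persists for any larger energy budget and smaller dissipation
floor. -/
theorem forall_subset_closure_lhLoudSet_mono {S : Finset (Fin 3 → ℤ)} {E E' ε ε' : ℝ}
    {U : Set (↥S → (EuclideanSpace ℂ (Fin 3)))} (h : ∀ j : ℕ, U ⊆ closure (lhLoudSet S E ε j)) (hE : E ≤ E')
    (hε : ε' ≤ ε) (j : ℕ) : U ⊆ closure (lhLoudSet S E' ε' j) :=
  (h j).trans (closure_mono (lhLoudSet_mono_budgets S hE hε j))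

/-- It suffices to produce Leray–Hopf loudness EVENTUALLY in `j`. -/
theorem forall_subset_closure_lhLoudSet_of_eventually {S : Finset (Fin 3 → ℤ)} {E ε : ℝ}
    {U : Set (↥S → (EuclideanSpace ℂ (Fin 3)))} {j₀ : ℕ} (h : ∀ j, j₀ ≤ j → U ⊆ closure (lhLoudSet S E ε j))
    (j : ℕ) : U ⊆ closure (lhLoudSet S E ε j) :=
  (h (max j j₀) (le_max_right _ _)).trans (closure_mono (lhLoudSet_antitone S E ε (le_max_left _ _)))

/-! ## §4 The Leray–Hopf power shell -/

section Shell

variable {S : Finset (Fin 3 → ℤ)}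

variable {E ε ν : ℝ} {c : ↥S → (EuclideanSpace ℂ (Fin 3))}
  {u₀ : (UnitAddTorus (Fin 3)) → (EuclideanSpace ℝ (Fin 3))} {u : ℝ → (UnitAddTorus (Fin 3)) → (EuclideanSpace ℝ (Fin 3))}

/-- LERAY–HOPF POWER BUDGET: every global Leray–Hopf solution forced by `f_c` obeys
`⟨ν‖∇u‖²⟩ ≤ ‖f_c‖₂ · ⟨‖u‖²⟩^{1/2}` (`limsup` averages, junk values included): dissipation ≤ injected power
(energy inequality from `0`, `DoeringFoias2002_dissipation_le_power_holds`) ≤ `‖f‖₂ U` (Cauchy–Schwarz, Jensen,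
bounded Cesàro energies; `Torus.IsGlobalLerayHopf.meanPower_le`). -/
theorem meanDissipation_le_of_isGlobalLerayHopf (hν : 0 < ν)
    (hu : Torus.IsGlobalLerayHopf ν (fun _ => force S c) u₀ u) :
    meanDissipation ν u ≤ Real.sqrt (∫ x, ‖force S c x‖ ^ 2) * Real.sqrt (meanEnergy u) := by
  have h1 : meanDissipation ν u ≤ meanPower (force S c) u :=
    DoeringFoias2002_dissipation_le_power_holds hν (memLp_force S c) (hasZeroMean_force S c) u₀ u hu
  have h2 := hu.meanPower_le hν (isSmooth_force S c) (hasZeroMean_force S c)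
  rw [rmsVelocity_eq_sqrt_meanEnergy] at h2
  exact h1.trans h2

/-- LEVEL SHELL (force form): `c ∈ LHLOUD_j(S,E,ε)`, `0 ≤ ε` ⇒ `ε² ≤ (∫‖f_c‖²)·E`. -/
theorem sq_le_integral_force_mul_of_mem_lhLoudSet (hε : 0 ≤ ε) {j : ℕ} (hc : c ∈ lhLoudSet S E ε j) :
    ε ^ 2 ≤ (∫ x, ‖force S c x‖ ^ 2) * E := by
  obtain ⟨ν, hν, -, u₀, u, hu, hEu, hεu⟩ := hc
  have hA : 0 ≤ ∫ x, ‖force S c x‖ ^ 2 := integral_nonneg fun _ => sq_nonneg _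
  have hmE : 0 ≤ meanEnergy u := meanEnergy_nonneg u
  have hεD : ε ≤ Real.sqrt (∫ x, ‖force S c x‖ ^ 2) * Real.sqrt (meanEnergy u) :=
    hεu.trans (meanDissipation_le_of_isGlobalLerayHopf hν hu)
  calc ε ^ 2 ≤ (Real.sqrt (∫ x, ‖force S c x‖ ^ 2) * Real.sqrt (meanEnergy u)) ^ 2 :=
        pow_le_pow_left₀ hε hεD 2
    _ = (∫ x, ‖force S c x‖ ^ 2) * meanEnergy u := by
        rw [mul_pow, Real.sq_sqrt hA, Real.sq_sqrt hmE]
    _ ≤ (∫ x, ‖force S c x‖ ^ 2) * E := mul_le_mul_of_nonneg_left hEu hA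

/-- A Leray–Hopf loud coefficient vector forces a NONNEGATIVE energy budget (mean energies are nonnegative, junk
values included). -/
theorem energy_nonneg_of_mem_lhLoudSet {j : ℕ} (hc : c ∈ lhLoudSet S E ε j) : 0 ≤ E := by
  obtain ⟨-, -, -, -, u, -, hEu, -⟩ := hc
  exact (meanEnergy_nonneg u).trans hEu

/-- LEVEL SHELL (coefficient form): `c ∈ LHLOUD_j(S,E,ε)`, `0 ≤ ε` ⇒ `ε² ≤ ‖c‖₂²·E`. -/
theorem sq_le_coeffNormSq_mul_of_mem_lhLoudSet (hε : 0 ≤ ε) {j : ℕ} (hc : c ∈ lhLoudSet S E ε j) :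
    ε ^ 2 ≤ coeffNormSq c * E :=
  (sq_le_integral_force_mul_of_mem_lhLoudSet hε hc).trans
    (mul_le_mul_of_nonneg_right (integral_norm_sq_force_le S c) (energy_nonneg_of_mem_lhLoudSet hc))

/-- QUIET BALL: with `ε > 0`, every `c` with `#S·‖c‖²·E < ε²` is Leray–Hopf quiet at every level, for EVERY datum
and EVERY global Leray–Hopf solution. -/
theorem not_mem_lhLoudSet_of_lt (hε : 0 < ε) {j : ℕ} (hc : S.card * ‖c‖ ^ 2 * E < ε ^ 2) :
    c ∉ lhLoudSet S E ε j := by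
  intro hmem
  have hE := energy_nonneg_of_mem_lhLoudSet hmem
  have h1 := sq_le_coeffNormSq_mul_of_mem_lhLoudSet hε.le hmem
  have h2 : coeffNormSq c * E ≤ S.card * ‖c‖ ^ 2 * E :=
    mul_le_mul_of_nonneg_right (coeffNormSq_le_card_mul c) hE
  linarith

variable (S)

/-- The Leray–Hopf loud sets lie in the CLOSED level shell `{c | ε² ≤ #S·‖c‖²·E}` (for `ε > 0`). -/
theorem lhLoudSet_subset_shell (hε : 0 < ε) (j : ℕ) :
    lhLoudSet S E ε j ⊆ {c : ↥S → (EuclideanSpace ℂ (Fin 3)) | ε ^ 2 ≤ S.card * ‖c‖ ^ 2 * E} := fun c hc => by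
  by_contra h
  exact not_mem_lhLoudSet_of_lt hε (not_le.1 h) hc

/-- … hence so do their closures. -/
theorem closure_lhLoudSet_subset_shell (hε : 0 < ε) (j : ℕ) :
    closure (lhLoudSet S E ε j) ⊆ {c : ↥S → (EuclideanSpace ℂ (Fin 3)) | ε ^ 2 ≤ S.card * ‖c‖ ^ 2 * E} :=
  closure_minimal (lhLoudSet_subset_shell S hε j) (isClosed_shell S E ε)

/-- AT REST IS NEVER LERAY–HOPF LOUD: `0 ∉ closure LHLOUD_j(S,E,ε)` for `ε > 0` (unforced Leray–Hopf solutions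
dissipate nothing on average, and small forces little). -/
theorem zero_not_mem_closure_lhLoudSet (hε : 0 < ε) (j : ℕ) :
    (0 : ↥S → (EuclideanSpace ℂ (Fin 3))) ∉ closure (lhLoudSet S E ε j) := fun h => by
  have := closure_lhLoudSet_subset_shell S hε j h
  simp only [mem_setOf_eq, norm_zero] at this
  nlinarith

variable {S}

/-- REFUTED STRENGTHENING (AtRest): no LH-window contains the zero force (density at level `0` already excludes it). -/
theorem zero_not_mem_of_subset_closure_lhLoudSet (hε : 0 < ε) {U : Set (↥S → (EuclideanSpace ℂ (Fin 3)))} {j : ℕ}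
    (hU : U ⊆ closure (lhLoudSet S E ε j)) : (0 : ↥S → (EuclideanSpace ℂ (Fin 3))) ∉ U := fun h0 =>
  zero_not_mem_closure_lhLoudSet S hε j (hU h0)

/-- A set in which some level's Leray–Hopf loud set is dense carries the shell inequality `ε² ≤ #S·‖c‖²·E` at each of
its points. -/
theorem shell_of_subset_closure_lhLoudSet (hε : 0 < ε) {U : Set (↥S → (EuclideanSpace ℂ (Fin 3)))} {j : ℕ}
    (hU : U ⊆ closure (lhLoudSet S E ε j)) (hc : c ∈ U) : ε ^ 2 ≤ S.card * ‖c‖ ^ 2 * E :=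
  closure_lhLoudSet_subset_shell S hε j (hU hc)

/-- … and, if non-empty, forces `E > 0`. -/
theorem energy_pos_of_subset_closure_lhLoudSet (hε : 0 < ε) {U : Set (↥S → (EuclideanSpace ℂ (Fin 3)))} {j : ℕ}
    (hU : U ⊆ closure (lhLoudSet S E ε j)) (hne : U.Nonempty) : 0 < E := by
  obtain ⟨c, hc⟩ := hne
  have h := shell_of_subset_closure_lhLoudSet hε hU hc
  by_contra hE
  push Not at hE
  have : (S.card : ℝ) * ‖c‖ ^ 2 * E ≤ 0 := mul_nonpos_of_nonneg_of_nonpos (by positivity) hE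
  nlinarith

variable (S)

/-- REFUTED STRENGTHENING (Everywhere): no Leray–Hopf loud set is dense in ALL of `P_S` (which contains `0`). -/
theorem not_univ_subset_closure_lhLoudSet (hε : 0 < ε) (j : ℕ) :
    ¬ (univ : Set (↥S → (EuclideanSpace ℂ (Fin 3)))) ⊆ closure (lhLoudSet S E ε j) :=
  fun h => zero_not_mem_of_subset_closure_lhLoudSet hε h (mem_univ _)

variable {S}

/-- DEGENERATE STOCK: over `S ⊆ {0}` the force vanishes, so every Leray–Hopf loud set is EMPTY (`ε > 0`):
unforced global Leray–Hopf solutions have zero mean dissipation (`meanDissipation ≤ meanPower 0 u = 0`).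
REFUTED STRENGTHENING (SameStock): the item with `S = S₀` fails at `S₀ = ∅`, `{0}`. -/
theorem lhLoudSet_eq_empty_of_subset (hS : S ⊆ {0}) (hε : 0 < ε) (j : ℕ) : lhLoudSet S E ε j = ∅ := by
  ext c
  simp only [mem_empty_iff_false, iff_false]
  intro hc
  have h := sq_le_integral_force_mul_of_mem_lhLoudSet hε.le hc
  rw [force_eq_zero_of_subset hS] at h
  simp only [Pi.zero_apply, norm_zero, ne_eq, OfNat.ofNat_ne_zero, not_false_eq_true, zero_pow,
    integral_zero, zero_mul] at h
  nlinarith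

/-- … hence over a degenerate stock `S ⊆ {0}` no non-empty set has a dense Leray–Hopf loud set at any level: provers must
put a non-zero mode into `S`. -/
theorem not_subset_closure_lhLoudSet_of_subset (hS : S ⊆ {0}) (hε : 0 < ε) {U : Set (↥S → (EuclideanSpace ℂ (Fin 3)))}
    (hne : U.Nonempty) (j : ℕ) : ¬ U ⊆ closure (lhLoudSet S E ε j) := fun h => by
  obtain ⟨c, hc⟩ := hne
  have := h hc
  rw [lhLoudSet_eq_empty_of_subset hS hε, closure_empty] at this
  exact this

/-! ### Witness anatomy: the enstrophy floor -/

/-- `meanDissipation ν u = ν · ⟨‖∇u‖₂²⟩` with the `limsup` mean of the spectral (`toReal`) gradient norm, for `ν ≥ 0`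
(nonnegative constants come out of `longTimeAvgSup`, junk values included). -/
theorem meanDissipation_eq_mul_longTimeAvgSup (hν : 0 ≤ ν) (u : ℝ → (UnitAddTorus (Fin 3)) → (EuclideanSpace ℝ (Fin 3))) :
    meanDissipation ν u = ν * longTimeAvgSup (fun t => (Torus.eGradNormSq (u t)).toReal) :=
  longTimeAvgSup_const_mul hν _

/-- ENSTROPHY FLOOR: every witness `(ν, u₀, u)` of `c ∈ LHLOUD_j(S,E,ε)` (`ε > 0`) has mean enstrophy
`⟨‖∇u‖₂²⟩ ≥ ε/ν > ε (j+1)` — the Leray–Hopf witnesses must carry `O(j)` mean-square gradients at level `j` while their energy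
stays `≤ E`: their spectral mass escapes every fixed Fourier band as `j → ∞` (Bernstein), exactly as for the crux. -/
theorem exists_witness_enstrophy_gt_of_mem_lhLoudSet (hε : 0 < ε) {j : ℕ} (hc : c ∈ lhLoudSet S E ε j) :
    ∃ (ν : ℝ) (u₀ : (UnitAddTorus (Fin 3)) → (EuclideanSpace ℝ (Fin 3)))
      (u : ℝ → (UnitAddTorus (Fin 3)) → (EuclideanSpace ℝ (Fin 3))),
      0 < ν ∧ ν < 1 / ((j : ℝ) + 1) ∧ Torus.IsGlobalLerayHopf ν (fun _ => force S c) u₀ u ∧ meanEnergy u ≤ E ∧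
        ε * ((j : ℝ) + 1) < longTimeAvgSup (fun t => (Torus.eGradNormSq (u t)).toReal) := by
  obtain ⟨ν, hν, hνj, u₀, u, hu, hEu, hεu⟩ := hc
  refine ⟨ν, u₀, u, hν, hνj, hu, hEu, ?_⟩
  set G : ℝ := longTimeAvgSup (fun t => (Torus.eGradNormSq (u t)).toReal) with hG
  rw [meanDissipation_eq_mul_longTimeAvgSup hν.le] at hεu
  have hj : (0 : ℝ) < (j : ℝ) + 1 := by positivity
  have h1 : ν * ((j : ℝ) + 1) < 1 := by rwa [lt_div_iff₀ hj] at hνj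
  -- `ε (j+1) < ε (j+1) · (1/(ν(j+1))) … ` : multiply `ε ≤ ν G` by `(j+1)` and use `ν (j+1) < 1`
  have hG0 : 0 ≤ G := by
    have : 0 ≤ ν * G := hε.le.trans hεu
    nlinarith [this, hν]
  nlinarith [mul_le_mul_of_nonneg_right hεu hj.le, hG0, hε, h1, mul_nonneg hν.le hG0]

end Shell

end Summit.AnomalousDissipation.AnomalousDissipation.Theorems.DenseLoudLerayHopfForces

end
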